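import Literature.MathematicalPhysics.QuantumFieldTheory.Federbush1986.ObservationCriterion
import Mathlib.GroupTheory.Congruence.Basic

/-!
# Federbush [F3] §5.3 2) p. 303: print's «simply connected» (every closed contour contracts by elementary homotopies) IS the
# normal generation of the free group on the non-tree bonds by the based plaquette words — the edge-path group of the lattice
# 2-complex, and the converse of `ObservationCriterion.normallyGenerated_of_simplyConnected`

statement-level skeleton of published theorems with citation tags; proofs where landed; nothing here is a claim about the Yang–Mills mass gap

SOURCE. [Federbush1987PhaseCellIII] P. Federbush, *A phase cell approach to Yang–Mills theory III. Local stability, modified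
renormalization group transformation*, Commun. Math. Phys. **110** (1987) 293–309, §5.3 2) p. 303 (text layer
`…/texts/fed1987-cmp110-III/p011.txt` L22–L27), verbatim: *«2) We will say a lattice is simply connected if every closed contour can
be modified to a trivial contour (a point) by a sequence of elementary homotopies. (See the discussion before Lemma 5.5.) …
Observation. In a simply connected lattice, if the bonds in a maximal tree are assigned the identity as a choice of gauge, then the
bond variables are uniquely determined by the plaquette variables.»*; §5.1 p. 301 (before Lemma 5.5): *«We consider two contours
Γ₁, Γ₂ differing by a single plaquette p. The plaquette provides an elementary homotopy between Γ₁ and Γ₂»*; §5.4 A) p. 306: free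
cancellations *«removing a portion of the contour consisting of the same bond traversed in both directions in sequence»*.

CITATION HEADER (lean-in-tree rule).  lit-balaban cell (HOME `run/shared/lean/pub/lit-balaban/`), Phase-2 proof seat p26 (gen 12;
free-target protocol G.5-34(d)), SKELETON row **F3.Eq5.26-5.40** (§5.3, head `absent`; owner r17, referee ref-5).  Companion of this
seat's `ObservationCriterion` (the dictionary tree-gauged configurations = homomorphisms of the free group, `univ`, `plaqWord`,
`NormallyGenerated`, and the direction simply connected ⇒ normally generated); p32's `SimplyConnectedObservation` (p308526:
`SimplyConnected`, `Spans`) and gen-5 contour calculus `LatticeContourHomotopy` / `Lemma54RectangleStokes` (`ElemHomotopy`,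
`Backtrack`, `MovesL`) used BY NAME.

WHAT IS PROVED (every `ℤ^d`; a lattice = bond set `Λ` with plaquettes `P`; a tree gauge = a bond set `T ⊆ Λ`).
* §1 `IsForest T` — print's «tree» in the contour calculus: every closed contour running in `T` contracts by free cancellations
  alone; `MovesL.symm'` (a sequence of homotopies run backwards crosses the same plaquettes with opposite orientation).
* §2 THE EDGE-PATH MONOID: the quotient `HQuot P` of the free monoid of contour words by the congruence generated by elementary
  homotopies across plaquettes of `P` and free cancellations (Mathlib `conGen`), the class map `cls`, `cls_append`,
  `cls_eq_of_movesL`, `cls_self_rev` (every word is invertible: `Γ·Γ⁻¹ ∼ ∅`), and the way back **`movesL_of_cls_eq`**: for `P`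
  closed under reversing orientation, equal classes ⇒ an honest forward sequence of moves.
* §3 tree paths `tp` from the base point (chosen through `Spans`), the LASSO `lasso T x₀ l = tp(src l)·l·tp(tgt l)⁻¹` of an
  oriented bond, `rev_lasso`, and the telescoping identity **`cls_conj_eq_prod_lasso`**: `cls (tp x · Γ · tp y⁻¹) = ∏_{l ∈ Γ}
  cls (lasso l)` for every contour `Γ : x → y`.
* §4 the homomorphism **`lassoHom : FreeGroup (Bond d) →* (HQuot P)ˣ`**, `of b ↦` the unit `cls (lasso (b, true))`; it realises
  words: `val_lassoHom_wordHol_of` (`lassoHom (g_Γ(of)) = cls (tp x · Γ · tp y⁻¹)`); it KILLS the tree letters when `T` is a forest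
  (`lassoHom_of_eq_one_of_mem`, hence `lassoHom_lift_univ`: it factors through `univ T`) and KILLS every based plaquette word of a
  plaquette of `P` (`lassoHom_plaqWord_eq_one`: one elementary homotopy), hence the normal closure
  (`normalClosure_le_ker_lassoHom`).
* §5 **`simplyConnected_of_normallyGenerated`**: `T ⊆ Λ` a forest spanning `Λ` from `x₀`, `P` closed under orientation reversal,
  and `NormallyGenerated P Λ T` ⇒ `SimplyConnected P Λ`; with `ObservationCriterion` the EQUIVALENCES
  **`simplyConnected_iff_normallyGenerated`** and **`simplyConnected_iff_forall_flatFor`** (print's simple connectivity ⇔ the flat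
  Observation for every group ⇔ `π₁` of the lattice 2-complex, presented on the non-tree bonds by the based plaquette words, is
  trivial), and `normallyGenerated_iff_of_isForest` (normal generation does not depend on the spanning forest chosen — generation
  does, `ObservationCriterion.not_generated_treeT` vs `generated_comb`); corollaries **`simplyConnected_of_generated`**,
  **`simplyConnected_of_peeling`** (a peelable lattice with a spanning forest gauge is simply connected).
* §6 **`isForest_of_potential`** (arborescences are forests: a potential increasing by one along every bond, distinct upper
  endpoints), **`isForest_combTree`**, and **`simplyConnected_box'`** — the box is simply connected once more, now through its comb
  peeling (independent of `SimplyConnectedBox.simplyConnected_box`); `normallyGenerated_box`.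

HONEST SCOPE.  This is the standard identification of the combinatorial («elementary homotopy») notion of simple connectivity of a
2-complex with the triviality of its edge-path group, carried out for [F3]'s lattice contours; [F3] states the definition and uses
simple connectivity only through the Observation.  Hypotheses beyond print's sentence, all satisfied by the box / block lattices of
this directory: the gauge bond set is a FOREST (print: «maximal tree») and the plaquette set is closed under reversing orientation
(an elementary homotopy run backwards crosses the plaquette with the opposite orientation).  Definitions with bodies only (`IsForest`, `Step`, `homotopyCon`, `HQuot`, `cls`, `tp`,
`Reach`, `lasso`, `lassoUnit`, `lassoHom`); everything else is a theorem; no `sorry`, axioms standard.  Unit `lit-balaban-p26`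
(literature-prover-lit-balaban-p26-g12-0).
-/

namespace Literature.MathematicalPhysics.QuantumFieldTheory.Federbush1986

namespace ObservationCriterion

open LatticeContour SimplyConnectedBox CombGaugeObservation PeelingObservation

variable {d : ℕ}

/-! ## §1 Forests; running a sequence of homotopies backwards -/

/-- **A forest** («the bonds in a maximal tree»), in the contour calculus: every closed contour all of whose bonds lie in `T`
contracts to the trivial contour by free cancellations alone (no plaquette needed). [cite: Federbush1987PhaseCellIII, §5.3 2) p. 303, §5.4 A) p. 306] -/
def IsForest (T : Set (Bond d)) : Prop :=
  ∀ (a : Site d) (Γ : List (Letter d)), IsPath a a Γ → (∀ l ∈ Γ, l.1 ∈ T) → MovesL [] Γ []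

/-- Unfolding `IsForest`. [cite: Federbush1987PhaseCellIII, §5.3 2) p. 303] -/
theorem isForest_iff (T : Set (Bond d)) :
    IsForest T ↔ ∀ (a : Site d) (Γ : List (Letter d)), IsPath a a Γ → (∀ l ∈ Γ, l.1 ∈ T) → MovesL [] Γ [] := Iff.rfl

/-- **Homotopies run backwards**: if `Γ₁` is carried to `Γ₂` across `p₁, …, p_n`, then `Γ₂` is carried to `Γ₁` across
`p_n, …, p₁` with reversed orientations. [cite: Federbush1987PhaseCellIII, §5.1 p. 301] -/
theorem _root_.Literature.MathematicalPhysics.QuantumFieldTheory.Federbush1986.LatticeContour.MovesL.symm'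
    {ps : List (LatticeContour.Plaq d)} {Γ₁ Γ₂ : List (Letter d)} (h : MovesL ps Γ₁ Γ₂) :
    MovesL (ps.reverse.map fun p => (p.1, p.2.2, p.2.1)) Γ₂ Γ₁ := by
  induction h with
  | refl => exact MovesL.refl _
  | homotopy _ hE ih => simpa using (MovesL.single hE.symm).trans ih
  | cancel _ hB ih => simpa using (MovesL.backtrack hB.symm).trans ih

/-- The group element of a contour depends only on the variables of its bonds. [cite: Federbush1987PhaseCellIII, (5.11) p. 300] -/
theorem wordHol_congr_letters {G : Type*} [Group G] {u u' : Bond d → G} (w : List (Letter d))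
    (h : ∀ l ∈ w, u l.1 = u' l.1) : wordHol u w = wordHol u' w := by
  induction w with
  | nil => rfl
  | cons l w ih =>
    rw [wordHol_cons', wordHol_cons', h l List.mem_cons_self, ih fun l' hl' => h l' (List.mem_cons_of_mem _ hl')]

/-! ## §2 The edge-path monoid: contour words modulo elementary homotopies and free cancellations -/

section EdgePath

variable (P : Set (LatticeContour.Plaq d))

/-- One move: an elementary homotopy across a plaquette of `P`, or a free cancellation. [cite: Federbush1987PhaseCellIII, §5.1 p. 301, §5.4 A) p. 306] -/
def Step (Γ₁ Γ₂ : List (Letter d)) : Prop :=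
  (∃ p ∈ P, ElemHomotopy p.1 p.2.1 p.2.2 Γ₁ Γ₂) ∨ Backtrack Γ₁ Γ₂

/-- The congruence on the free monoid of contour words generated by the moves («modified … by a sequence of elementary
homotopies»). [cite: Federbush1987PhaseCellIII, §5.3 2) p. 303] -/
def homotopyCon : Con (FreeMonoid (Letter d)) :=
  conGen fun x y => Step P (FreeMonoid.toList x) (FreeMonoid.toList y)

/-- The edge-path monoid of the lattice with plaquettes `P`: contour words modulo moves. [cite: Federbush1987PhaseCellIII, §5.3 2) p. 303] -/
abbrev HQuot : Type := (homotopyCon P).Quotient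

/-- The class of a contour word in the edge-path monoid. [cite: Federbush1987PhaseCellIII, §5.3 2) p. 303] -/
def cls (Γ : List (Letter d)) : HQuot P := ((FreeMonoid.ofList Γ : FreeMonoid (Letter d)) : (homotopyCon P).Quotient)

/-- Concatenation of contours is multiplication of classes. [cite: Federbush1987PhaseCellIII, §5.1 p. 300] -/
theorem cls_append (Γ₁ Γ₂ : List (Letter d)) : cls P (Γ₁ ++ Γ₂) = cls P Γ₁ * cls P Γ₂ := by
  rw [cls, FreeMonoid.ofList_append, Con.coe_mul]; rfl

/-- The trivial contour is the unit. [cite: Federbush1987PhaseCellIII, §5.3 2) p. 303] -/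
theorem cls_nil : cls P ([] : List (Letter d)) = 1 := rfl

variable {P}

/-- One move identifies classes. [cite: Federbush1987PhaseCellIII, §5.1 p. 301] -/
theorem cls_eq_of_step {Γ₁ Γ₂ : List (Letter d)} (h : Step P Γ₁ Γ₂) : cls P Γ₁ = cls P Γ₂ :=
  (Con.eq _).2 (ConGen.Rel.of _ _ h)

/-- A sequence of moves across plaquettes of `P` identifies classes. [cite: Federbush1987PhaseCellIII, Lemma 5.5 p. 301] -/
theorem cls_eq_of_movesL {ps : List (LatticeContour.Plaq d)} {Γ₁ Γ₂ : List (Letter d)} (h : MovesL ps Γ₁ Γ₂)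
    (hps : ∀ p ∈ ps, p ∈ P) : cls P Γ₁ = cls P Γ₂ := by
  induction h with
  | refl => rfl
  | @homotopy ps _ _ _ z μ ν _ hE ih =>
    exact (ih fun p hp => hps p (List.mem_append_left _ hp)).trans
      (cls_eq_of_step (Or.inl ⟨(z, μ, ν), hps _ (by simp), hE⟩))
  | cancel _ hB ih => exact (ih hps).trans (cls_eq_of_step (Or.inr hB))

/-- `Γ·Γ⁻¹ ∼ ∅`: every class has a right inverse. [cite: Federbush1987PhaseCellIII, §5.4 A) p. 306] -/
theorem cls_self_rev (Γ : List (Letter d)) : cls P (Γ ++ rev Γ) = 1 :=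
  cls_eq_of_movesL (movesL_self_rev Γ) (by simp)

/-- `Γ⁻¹·Γ ∼ ∅`: … and a left inverse. [cite: Federbush1987PhaseCellIII, §5.4 A) p. 306] -/
theorem cls_rev_self (Γ : List (Letter d)) : cls P (rev Γ ++ Γ) = 1 :=
  cls_eq_of_movesL (movesL_rev_append_nil Γ) (by simp)

/-- Inserting `Γ⁻¹·Γ` in the middle does not change the class. [cite: Federbush1987PhaseCellIII, §5.4 A) p. 306] -/
theorem cls_insert_rev_self (A Γ B : List (Letter d)) : cls P (A ++ rev Γ ++ Γ ++ B) = cls P (A ++ B) := by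
  rw [List.append_assoc A, cls_append, cls_append, cls_rev_self, mul_one, cls_append]

/-- **Back from the congruence to honest moves.**  If `P` is closed under reversing orientation, two words with the same class
are joined by a forward sequence of moves across plaquettes of `P` (symmetric steps are re-oriented by `MovesL.symm'`).
[cite: Federbush1987PhaseCellIII, §5.1 p. 301, §5.3 2) p. 303] -/
theorem movesL_of_cls_eq (hPs : ∀ p ∈ P, (p.1, p.2.2, p.2.1) ∈ P) {Γ₁ Γ₂ : List (Letter d)}
    (h : cls P Γ₁ = cls P Γ₂) : ∃ ps : List (LatticeContour.Plaq d), (∀ p ∈ ps, p ∈ P) ∧ MovesL ps Γ₁ Γ₂ := by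
  have key : ∀ x y : FreeMonoid (Letter d), ConGen.Rel (fun x y => Step P (FreeMonoid.toList x) (FreeMonoid.toList y)) x y →
      ∃ ps : List (LatticeContour.Plaq d), (∀ p ∈ ps, p ∈ P) ∧ MovesL ps (FreeMonoid.toList x) (FreeMonoid.toList y) := by
    intro x y hxy
    induction hxy with
    | of x y hs =>
      rcases hs with ⟨p, hp, hE⟩ | hB
      · exact ⟨[(p.1, p.2.1, p.2.2)], by simpa using hp, MovesL.single hE⟩
      · exact ⟨[], by simp, MovesL.backtrack hB⟩
    | refl x => exact ⟨[], by simp, MovesL.refl _⟩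
    | symm _ ih =>
      obtain ⟨ps, hps, hm⟩ := ih
      refine ⟨ps.reverse.map fun p => (p.1, p.2.2, p.2.1), fun p hp => ?_, hm.symm'⟩
      simp only [List.mem_map, List.mem_reverse] at hp
      obtain ⟨q, hq, rfl⟩ := hp
      exact hPs q (hps q hq)
    | trans _ _ ih₁ ih₂ =>
      obtain ⟨ps, hps, hm⟩ := ih₁
      obtain ⟨qs, hqs, hm'⟩ := ih₂
      exact ⟨ps ++ qs, fun p hp => by rcases List.mem_append.1 hp with h | h <;> [exact hps p h; exact hqs p h], hm.trans hm'⟩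
    | @mul w x y z _ _ ih₁ ih₂ =>
      obtain ⟨ps, hps, hm⟩ := ih₁
      obtain ⟨qs, hqs, hm'⟩ := ih₂
      refine ⟨ps ++ qs, fun p hp => by rcases List.mem_append.1 hp with h | h <;> [exact hps p h; exact hqs p h], ?_⟩
      rw [FreeMonoid.toList_mul, FreeMonoid.toList_mul]
      have h1 := hm.frame [] (FreeMonoid.toList y)
      have h2 := hm'.frame (FreeMonoid.toList x) []
      simp only [List.nil_append, List.append_nil] at h1 h2
      exact h1.trans h2
  exact key _ _ ((Con.eq _).1 h)

end EdgePath

/-! ## §3 Tree paths, lassos, and the telescoping identity -/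

section Lasso

variable (T : Set (Bond d)) (x₀ : Site d)

/-- A site is reached by the tree from the base point. [cite: Federbush1987PhaseCellIII, §5.3 2) p. 303] -/
def Reach (x : Site d) : Prop := ∃ τ : List (Letter d), IsPath x₀ x τ ∧ ∀ l ∈ τ, l.1 ∈ T

/-- A chosen tree path from the base point to `x` (the trivial word if `x` is not reached). [cite: Federbush1987PhaseCellIII, §5.3 2) p. 303] -/
noncomputable def tp (x : Site d) : List (Letter d) :=
  by classical exact if h : Reach T x₀ x then h.choose else []

/-- The chosen tree path is a tree path. [cite: Federbush1987PhaseCellIII, §5.3 2) p. 303] -/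
theorem tp_spec {x : Site d} (h : Reach T x₀ x) : IsPath x₀ x (tp T x₀ x) ∧ ∀ l ∈ tp T x₀ x, l.1 ∈ T := by
  unfold tp; rw [dif_pos h]; exact h.choose_spec

/-- **The lasso** of an oriented bond: tree path to its initial point, the bond, tree path back from its final point — the based loop
representing the bond in `π₁` of the 1-skeleton. [cite: Federbush1987PhaseCellIII, §5.3 2) p. 303] -/
noncomputable def lasso (l : Letter d) : List (Letter d) := tp T x₀ (src l) ++ [l] ++ rev (tp T x₀ (tgt l))

/-- The reversed lasso is the lasso of the reversed bond. [cite: Federbush1987PhaseCellIII, §5.1 p. 300] -/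
theorem rev_lasso (l : Letter d) : rev (lasso T x₀ l) = lasso T x₀ (opp l) := by
  simp [lasso, rev_append, List.append_assoc]

variable {T x₀} {P : Set (LatticeContour.Plaq d)}

/-- **Telescoping.**  For a contour `Γ : x → y`, `cls (tp x · Γ · (tp y)⁻¹) = ∏_{l ∈ Γ} cls (lasso l)`: insert `tp(v)⁻¹·tp(v)` at
every intermediate vertex `v` (free cancellations). [cite: Federbush1987PhaseCellIII, §5.3 2) p. 303, §5.4 A) p. 306] -/
theorem cls_conj_eq_prod_lasso {x y : Site d} {Γ : List (Letter d)} (hΓ : IsPath x y Γ) :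
    cls P (tp T x₀ x ++ Γ ++ rev (tp T x₀ y)) = (Γ.map fun l => cls P (lasso T x₀ l)).prod := by
  induction Γ generalizing x with
  | nil =>
    simp only [isPath_nil] at hΓ
    subst hΓ
    rw [List.append_nil, cls_self_rev, List.map_nil, List.prod_nil]
  | cons l Γ ih =>
    obtain ⟨hsrc, htail⟩ := isPath_cons.1 hΓ
    rw [List.map_cons, List.prod_cons, ← ih htail, lasso, hsrc, ← cls_append,
      show tp T x₀ x ++ l :: Γ ++ rev (tp T x₀ y) = (tp T x₀ x ++ [l]) ++ (Γ ++ rev (tp T x₀ y)) by simp,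
      ← cls_insert_rev_self (tp T x₀ x ++ [l]) (tp T x₀ (tgt l)) (Γ ++ rev (tp T x₀ y))]
    simp [List.append_assoc]

end Lasso

/-! ## §4 The lasso homomorphism out of the free group on the bonds -/

section LassoHom

variable (P : Set (LatticeContour.Plaq d)) (T : Set (Bond d)) (x₀ : Site d)

/-- The class of the lasso of a bond as a UNIT of the edge-path monoid (inverse: the lasso of the reversed bond).
[cite: Federbush1987PhaseCellIII, §5.3 2) p. 303] -/
noncomputable def lassoUnit (b : Bond d) : (HQuot P)ˣ where
  val := cls P (lasso T x₀ (b, true))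
  inv := cls P (lasso T x₀ (b, false))
  val_inv := by
    rw [← cls_append, show ((b, false) : Letter d) = opp (b, true) from rfl, ← rev_lasso, cls_self_rev]
  inv_val := by
    rw [← cls_append, show ((b, true) : Letter d) = opp (b, false) from rfl, ← rev_lasso, cls_self_rev]

/-- **The lasso homomorphism** `FreeGroup (Bond d) →* (HQuot P)ˣ`, `of b ↦ [lasso b]` — configurations of the free group read as
based loops. [cite: Federbush1987PhaseCellIII, §5.3 2) p. 303] -/
noncomputable def lassoHom : FreeGroup (Bond d) →* (HQuot P)ˣ := FreeGroup.lift (lassoUnit P T x₀)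

variable {P T x₀}

/-- The value of the lasso homomorphism on an oriented bond is the class of its lasso, either orientation.
[cite: Federbush1987PhaseCellIII, §5.3 2) p. 303] -/
theorem val_lassoHom_letter (l : Letter d) :
    ((if l.2 then lassoHom P T x₀ (FreeGroup.of l.1) else (lassoHom P T x₀ (FreeGroup.of l.1))⁻¹ : (HQuot P)ˣ) : HQuot P) =
      cls P (lasso T x₀ l) := by
  obtain ⟨b, _ | _⟩ := l <;> simp [lassoHom, lassoUnit]

/-- **The lasso homomorphism realises contours**: on the word `g_Γ` of a contour `Γ : x → y` (read with the free generators as bond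
variables) its value is the class of `tp x · Γ · (tp y)⁻¹`. [cite: Federbush1987PhaseCellIII, (5.11) p. 300, §5.3 2) p. 303] -/
theorem val_lassoHom_wordHol_of {x y : Site d} {Γ : List (Letter d)} (hΓ : IsPath x y Γ) :
    ((lassoHom P T x₀ (wordHol FreeGroup.of Γ) : (HQuot P)ˣ) : HQuot P) = cls P (tp T x₀ x ++ Γ ++ rev (tp T x₀ y)) := by
  rw [cls_conj_eq_prod_lasso hΓ, ← wordHol_comp]
  clear hΓ
  induction Γ with
  | nil => simp
  | cons l Γ ih =>
    rw [wordHol_cons', Units.val_mul, ih, List.map_cons, List.prod_cons, Function.comp_apply, ← val_lassoHom_letter l]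

/-- **Tree letters are killed** when `T` is a forest: the lasso of a tree bond is a closed contour in `T`.
[cite: Federbush1987PhaseCellIII, §5.3 2) p. 303] -/
theorem lassoHom_of_eq_one_of_mem (hT : IsForest T) {b : Bond d} (hb : b ∈ T) (h₁ : Reach T x₀ b.1)
    (h₂ : Reach T x₀ (b.1 + ev b.2)) : lassoHom P T x₀ (FreeGroup.of b) = 1 := by
  ext
  have hval : ((lassoHom P T x₀ (FreeGroup.of b) : (HQuot P)ˣ) : HQuot P) = cls P (lasso T x₀ (b, true)) := by
    simp [lassoHom, lassoUnit]
  rw [hval, Units.val_one, ← cls_nil P]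
  refine cls_eq_of_movesL (hT x₀ _ ?_ ?_) (by simp)
  · exact ((tp_spec T x₀ h₁).1.append (isPath_singleton.2 ⟨rfl, rfl⟩)).append (tp_spec T x₀ h₂).1.rev
  · intro l hl
    simp only [lasso, src_true, tgt_true, List.append_assoc, List.mem_append, List.mem_singleton] at hl
    rcases hl with h | rfl | h
    · exact (tp_spec T x₀ h₁).2 l h
    · exact hb
    · obtain ⟨l', hl', he⟩ := exists_mem_of_mem_rev h
      rw [← he]; exact (tp_spec T x₀ h₂).2 l' hl'

/-- Hence, when the forest `T ⊆ Λ` spans `Λ` from the base point, the lasso homomorphism FACTORS THROUGH the universal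
tree-gauged configuration: on every contour word, `lassoHom (g_Γ(univ T)) = lassoHom (g_Γ(of))`.
[cite: Federbush1987PhaseCellIII, §5.3 2) Observation p. 303] -/
theorem lassoHom_wordHol_univ {Λ : Set (Bond d)} (hT : IsForest T) (hTΛ : T ⊆ Λ) (hspan : Spans T Λ x₀)
    (Γ : List (Letter d)) :
    lassoHom P T x₀ (wordHol (univ T) Γ) = lassoHom P T x₀ (wordHol FreeGroup.of Γ) := by
  rw [← wordHol_comp, ← wordHol_comp]
  refine wordHol_congr_letters Γ fun l _ => ?_
  simp only [Function.comp_apply]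
  by_cases hlT : l.1 ∈ T
  · have h₁ : Reach T x₀ l.1.1 := by simpa [Reach] using hspan (l.1, true) (hTΛ hlT)
    have h₂ : Reach T x₀ (l.1.1 + ev l.1.2) := by simpa [Reach] using hspan (l.1, false) (hTΛ hlT)
    rw [univ_of_mem hlT, map_one, lassoHom_of_eq_one_of_mem hT hlT h₁ h₂]
  · rw [univ_of_not_mem hlT]

/-- **Plaquette words are killed**: for a plaquette of `P`, one elementary homotopy (an insertion of `∂p`) joins the lasso
`tp z · (tp z)⁻¹ ∼ ∅` to `tp z · ∂p · (tp z)⁻¹`. [cite: Federbush1987PhaseCellIII, §5.1 p. 301, §5.3 2) p. 303] -/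
theorem lassoHom_plaqWord_eq_one {Λ : Set (Bond d)} (hT : IsForest T) (hTΛ : T ⊆ Λ) (hspan : Spans T Λ x₀)
    {p : LatticeContour.Plaq d} (hp : p ∈ P) :
    lassoHom P T x₀ (plaqWord T p) = 1 := by
  ext
  rw [plaqWord_def, lassoHom_wordHol_univ hT hTΛ hspan, val_lassoHom_wordHol_of (isPath_plaqLoop p.1 p.2.1 p.2.2),
    Units.val_one, ← cls_self_rev (P := P) (tp T x₀ p.1)]
  symm
  refine cls_eq_of_step (Or.inl ⟨p, hp, tp T x₀ p.1, [], plaqLoop p.1 p.2.1 p.2.2, rev (tp T x₀ p.1), by simp, by simp, ?_⟩)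
  simpa using List.IsRotated.refl _

/-- So the normal closure of the based plaquette words lies in the kernel of the lasso homomorphism.
[cite: Federbush1987PhaseCellIII, §5.3 2) p. 303] -/
theorem normalClosure_le_ker_lassoHom {Λ : Set (Bond d)} (hT : IsForest T) (hTΛ : T ⊆ Λ) (hspan : Spans T Λ x₀) :
    Subgroup.normalClosure (plaqWord T '' P) ≤ (lassoHom P T x₀).ker :=
  Subgroup.normalClosure_le_normal (by
    rintro _ ⟨p, hp, rfl⟩
    rw [SetLike.mem_coe, MonoidHom.mem_ker]
    exact lassoHom_plaqWord_eq_one hT hTΛ hspan hp)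

end LassoHom

/-! ## §5 Simply connected ⇔ normally generated ⇔ the flat Observation for every group -/

section Main

variable {P : Set (LatticeContour.Plaq d)} {Λ T : Set (Bond d)} {x₀ : Site d}

/-- The tree-gauge word of a contour of `Λ` lies in the normal closure of the plaquette words, under normal generation.
[cite: Federbush1987PhaseCellIII, §5.3 2) p. 303] -/
theorem NormallyGenerated.wordHol_univ_mem (h : NormallyGenerated P Λ T) {Γ : List (Letter d)} (hΛ : ∀ l ∈ Γ, l.1 ∈ Λ) :
    wordHol (univ T) Γ ∈ Subgroup.normalClosure (plaqWord T '' P) := by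
  induction Γ with
  | nil => exact one_mem _
  | cons l Γ ih =>
    rw [wordHol_cons']
    refine mul_mem ?_ (ih fun l' hl' => hΛ l' (List.mem_cons_of_mem _ hl'))
    have hl := h l.1 (hΛ l List.mem_cons_self)
    split_ifs
    · exact hl
    · exact inv_mem hl

/-- **Normal generation ⇒ simply connected.**  On the lattice `Λ` spanned from `x₀` by the forest `T ⊆ Λ`, with plaquettes `P`
closed under reversing orientation and having their sides in `Λ`: if the based plaquette words normally generate, then every
closed contour of `Λ` is carried to the trivial contour by elementary homotopies across plaquettes of `P` — the word of `Γ` lies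
in the normal closure, hence in the kernel of the lasso homomorphism, so `cls (tp a · Γ · (tp a)⁻¹) = 1`, which unwinds to an honest
sequence of moves, and `Γ ∼ (tp a)⁻¹·(tp a · Γ · (tp a)⁻¹)·tp a`. [cite: Federbush1987PhaseCellIII, §5.3 2) p. 303] -/
theorem simplyConnected_of_normallyGenerated (hTΛ : T ⊆ Λ) (hspan : Spans T Λ x₀) (hT : IsForest T)
    (hPs : ∀ p ∈ P, (p.1, p.2.2, p.2.1) ∈ P) (h : NormallyGenerated P Λ T) : SimplyConnected P Λ := by
  intro a Γ hΓ hΛ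
  -- the class of the conjugated contour is trivial
  have hker := normalClosure_le_ker_lassoHom (P := P) (x₀ := x₀) hT hTΛ hspan (h.wordHol_univ_mem hΛ)
  rw [MonoidHom.mem_ker, lassoHom_wordHol_univ hT hTΛ hspan Γ] at hker
  have hcls : cls P (tp T x₀ a ++ Γ ++ rev (tp T x₀ a)) = cls P [] := by
    rw [← val_lassoHom_wordHol_of hΓ, hker, Units.val_one, cls_nil]
  obtain ⟨ps, hps, hm⟩ := movesL_of_cls_eq hPs hcls
  -- unwind the conjugation by free cancellations
  set τ := tp T x₀ a
  have h1 : MovesL [] Γ (rev τ ++ (τ ++ Γ ++ rev τ) ++ τ) := by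
    have ha := (movesL_nil_rev_append τ).frame [] Γ
    have hb := (movesL_nil_rev_append τ).frame (rev τ ++ τ ++ Γ) []
    simp only [List.nil_append, List.append_nil] at ha hb
    simpa [List.append_assoc] using ha.trans hb
  have h2 : MovesL ps (rev τ ++ (τ ++ Γ ++ rev τ) ++ τ) (rev τ ++ [] ++ τ) := hm.frame (rev τ) τ
  have h3 : MovesL [] (rev τ ++ [] ++ τ) [] := by simpa using movesL_rev_append_nil τ
  exact ⟨ps, hps, by simpa using (h1.trans h2).trans h3⟩

/-- **Simply connected ⇔ normally generated** (print's homotopy definition = triviality of the edge-path group presented on the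
non-tree bonds by the based plaquette words). [cite: Federbush1987PhaseCellIII, §5.3 2) p. 303] -/
theorem simplyConnected_iff_normallyGenerated (hTΛ : T ⊆ Λ) (hspan : Spans T Λ x₀) (hT : IsForest T)
    (hPs : ∀ p ∈ P, (p.1, p.2.2, p.2.1) ∈ P) : SimplyConnected P Λ ↔ NormallyGenerated P Λ T :=
  ⟨fun hsc => normallyGenerated_of_simplyConnected hsc hTΛ hspan, simplyConnected_of_normallyGenerated hTΛ hspan hT hPs⟩

/-- **Simply connected ⇔ the flat Observation for every group**: «every flat connection is pure gauge» characterises print's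
simple connectivity. [cite: Federbush1987PhaseCellIII, §5.3 2) Observation p. 303] -/
theorem simplyConnected_iff_forall_flatFor (hTΛ : T ⊆ Λ) (hspan : Spans T Λ x₀) (hT : IsForest T)
    (hPs : ∀ p ∈ P, (p.1, p.2.2, p.2.1) ∈ P) : SimplyConnected P Λ ↔ ∀ (G : Type) [Group G], FlatFor G P Λ T := by
  rw [simplyConnected_iff_normallyGenerated hTΛ hspan hT hPs, normallyGenerated_iff_forall_flatFor]

/-- **Normal generation does not depend on the spanning forest** (generation does: `not_generated_treeT` against `generated_comb`).
[cite: Federbush1987PhaseCellIII, §5.3 2) p. 303] -/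
theorem NormallyGenerated.of_isForest {T' : Set (Bond d)} {x₀' : Site d} (hTΛ : T ⊆ Λ) (hspan : Spans T Λ x₀)
    (hT : IsForest T) (hT'Λ : T' ⊆ Λ) (hspan' : Spans T' Λ x₀') (hPs : ∀ p ∈ P, (p.1, p.2.2, p.2.1) ∈ P)
    (h : NormallyGenerated P Λ T) : NormallyGenerated P Λ T' :=
  normallyGenerated_of_simplyConnected (simplyConnected_of_normallyGenerated hTΛ hspan hT hPs h) hT'Λ hspan'

/-- Two spanning forests of the same lattice give the same normal-generation condition. [cite: Federbush1987PhaseCellIII, §5.3 2) p. 303] -/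
theorem normallyGenerated_iff_of_isForest {T' : Set (Bond d)} {x₀' : Site d} (hTΛ : T ⊆ Λ) (hspan : Spans T Λ x₀)
    (hT : IsForest T) (hT'Λ : T' ⊆ Λ) (hspan' : Spans T' Λ x₀') (hT' : IsForest T')
    (hPs : ∀ p ∈ P, (p.1, p.2.2, p.2.1) ∈ P) : NormallyGenerated P Λ T ↔ NormallyGenerated P Λ T' :=
  ⟨fun h => h.of_isForest hTΛ hspan hT hT'Λ hspan' hPs, fun h => h.of_isForest hT'Λ hspan' hT' hTΛ hspan hPs⟩

/-- **Generation ⇒ simply connected** (through normal generation). [cite: Federbush1987PhaseCellIII, §5.3 2) p. 303] -/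
theorem simplyConnected_of_generated (hTΛ : T ⊆ Λ) (hspan : Spans T Λ x₀) (hT : IsForest T)
    (hPs : ∀ p ∈ P, (p.1, p.2.2, p.2.1) ∈ P) (h : Generated P Λ T) : SimplyConnected P Λ :=
  simplyConnected_of_normallyGenerated hTΛ hspan hT hPs h.normallyGenerated

/-- **Peelable ⇒ simply connected**: a lattice peelable relative to a spanning forest gauge (an axial / comb / staircase / nice-block
gauge of `PeelingObservation`, `PuncturedBlockPeeling`) is simply connected in print's sense — the peeling is a collapse of the
2-complex. [cite: Federbush1987PhaseCellIII, §5.3 2)–3) p. 303] -/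
theorem simplyConnected_of_peeling (π : Peeling P Λ T) (hTΛ : T ⊆ Λ) (hspan : Spans T Λ x₀) (hT : IsForest T)
    (hPs : ∀ p ∈ P, (p.1, p.2.2, p.2.1) ∈ P) : SimplyConnected P Λ :=
  simplyConnected_of_generated hTΛ hspan hT hPs (generated_of_peeling π)

end Main

/-! ## §6 Forests from a potential: the comb is a forest; the box is simply connected once more, through its comb peeling -/

section Forest

variable {T : Set (Bond d)}

/-- Along a contour in `T` a potential increasing by one along every bond of `T` changes by (forward letters) − (backward letters).
[cite: Federbush1987PhaseCellIII, §5.1 p. 300] -/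
theorem potential_tgt_sub_src (φ : Site d → ℤ) (hφ : ∀ b ∈ T, φ (b.1 + ev b.2) = φ b.1 + 1) {x y : Site d}
    {Γ : List (Letter d)} (hΓ : IsPath x y Γ) (hT : ∀ l ∈ Γ, l.1 ∈ T) :
    φ y - φ x = (Γ.map fun l : Letter d => if l.2 then (1 : ℤ) else -1).sum := by
  induction Γ generalizing x with
  | nil => simp only [isPath_nil] at hΓ; subst hΓ; simp
  | cons l Γ ih =>
    obtain ⟨hsrc, htail⟩ := isPath_cons.1 hΓ
    have h1 := ih htail fun l' hl' => hT l' (List.mem_cons_of_mem _ hl')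
    have h2 := hφ l.1 (hT l List.mem_cons_self)
    rw [List.map_cons, List.sum_cons, ← h1, ← hsrc]
    obtain ⟨b, _ | _⟩ := l
    · simp only [src_false, tgt_false, Bool.false_eq_true, if_false] at h2 ⊢; omega
    · simp only [src_true, tgt_true, if_true] at h2 ⊢; omega

/-- A list of orientations either has a forward letter immediately followed by a backward one, or consists of backward letters
followed by forward letters. [cite: Federbush1987PhaseCellIII, §5.4 A) p. 306] -/
theorem exists_peak_or_monotone (Γ : List (Letter d)) :
    (∃ (A : List (Letter d)) (l l' : Letter d) (B : List (Letter d)), Γ = A ++ l :: l' :: B ∧ l.2 = true ∧ l'.2 = false) ∨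
      ∃ k m : ℕ, Γ.map (fun l => l.2) = List.replicate k false ++ List.replicate m true := by
  induction Γ with
  | nil => exact Or.inr ⟨0, 0, by simp⟩
  | cons l Γ ih =>
    rcases ih with ⟨A, l₁, l₂, B, rfl, h₁, h₂⟩ | ⟨k, m, hkm⟩
    · exact Or.inl ⟨l :: A, l₁, l₂, B, by simp, h₁, h₂⟩
    · obtain ⟨b, _ | _⟩ := l
      · refine Or.inr ⟨k + 1, m, ?_⟩
        rw [List.map_cons, hkm]; simp [List.replicate_succ]
      · cases Γ with
        | nil => exact Or.inr ⟨0, 1, by simp⟩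
        | cons l' Γ' =>
          obtain ⟨b', _ | _⟩ := l'
          · exact Or.inl ⟨[], (b, true), (b', false), Γ', by simp, rfl, rfl⟩
          · refine Or.inr ⟨0, m + 1, ?_⟩
            cases k with
            | zero => rw [List.map_cons, hkm]; simp [List.replicate_succ]
            | succ k => simp [List.replicate_succ] at hkm

/-- **Forests from a potential (arborescences).**  If a potential increases by one along every bond of `T` and distinct bonds of `T`
have distinct upper endpoints, then `T` is a forest: a closed contour in `T` has a forward letter followed by the backward letter of
the SAME bond (at a vertex of locally maximal potential) — a free cancellation — or starts down and ends up the same bond; induction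
on the length. [cite: Federbush1987PhaseCellIII, §5.3 2) p. 303, §5.4 A) p. 306] -/
theorem isForest_of_potential (φ : Site d → ℤ) (hφ : ∀ b ∈ T, φ (b.1 + ev b.2) = φ b.1 + 1)
    (hinj : ∀ b ∈ T, ∀ b' ∈ T, b.1 + ev b.2 = b'.1 + ev b'.2 → b = b') : IsForest T := by
  suffices key : ∀ (n : ℕ) (a : Site d) (Γ : List (Letter d)), Γ.length = n → IsPath a a Γ →
      (∀ l ∈ Γ, l.1 ∈ T) → MovesL [] Γ [] from fun a Γ h1 h2 => key _ a Γ rfl h1 h2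
  intro n
  induction n using Nat.strong_induction_on with
  | _ n ih =>
    intro a Γ hn hΓ hT
    rcases exists_peak_or_monotone Γ with ⟨A, l, l', B, rfl, h₁, h₂⟩ | ⟨k, m, hkm⟩
    · -- a forward letter followed by a backward letter: the same bond (injectivity) — a free cancellation
      obtain ⟨c, hA, hrest⟩ := isPath_append_iff.1 hΓ
      obtain ⟨hl, hrest'⟩ := isPath_cons.1 hrest
      obtain ⟨hl', hB⟩ := isPath_cons.1 hrest'
      obtain ⟨b, s⟩ := l
      obtain ⟨b', s'⟩ := l'
      simp only at h₁ h₂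
      subst h₁; subst h₂
      have hb : b ∈ T := hT (b, true) (by simp)
      have hb' : b' ∈ T := hT (b', false) (by simp)
      have hbb : b = b' := hinj b hb b' hb' (by simpa using hl'.symm)
      subst hbb
      have hAB : IsPath a a (A ++ B) := by
        refine hA.append ?_
        simp only [tgt_false] at hB
        simp only [src_true] at hl
        rwa [hl] at hB
      have hlen : (A ++ B).length < n := by rw [← hn]; simp
      have hmv := ih _ hlen a (A ++ B) rfl hAB fun l hl => hT l (by
        rcases List.mem_append.1 hl with h | h
        · exact List.mem_append_left _ h
        · exact List.mem_append_right _ (List.mem_cons_of_mem _ (List.mem_cons_of_mem _ h)))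
      have hbt : Backtrack (A ++ (b, true) :: (b, false) :: B) (A ++ B) :=
        ⟨A, (b, true), B, Or.inl ⟨by simp [opp], rfl⟩⟩
      simpa using (MovesL.backtrack hbt).trans hmv
    · -- all backward letters first, then all forward letters
      by_cases hΓ0 : Γ = []
      · subst hΓ0; exact MovesL.refl _
      obtain ⟨M, lₙ, hMl⟩ : ∃ (M : List (Letter d)) (lₙ : Letter d), Γ = M ++ [lₙ] :=
        ⟨Γ.dropLast, Γ.getLast hΓ0, (List.dropLast_append_getLast hΓ0).symm⟩
      subst hMl
      have hsum := potential_tgt_sub_src φ hφ hΓ hT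
      rw [sub_self] at hsum
      -- the orientation profile is `k` falses then `m` trues with `k = m ≥ 1`
      have hcount : ((M ++ [lₙ]).map fun l : Letter d => if l.2 then (1 : ℤ) else -1) =
          ((M ++ [lₙ]).map fun l => l.2).map fun s : Bool => if s then (1 : ℤ) else -1 := by simp
      rw [hcount, hkm] at hsum
      simp only [List.map_append, List.map_replicate, List.sum_append, List.sum_replicate, Bool.false_eq_true,
        ↓reduceIte, nsmul_eq_mul, mul_neg, mul_one] at hsum
      have hk : m = k := by omega
      rw [hk] at hkm
      clear hk hsum hcount
      have hlast : lₙ.2 = true := by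
        cases k with
        | zero => have h0 := congrArg List.length hkm; simp at h0
        | succ k =>
          have h0 := congrArg List.getLast? hkm
          rw [List.map_append, List.map_singleton, List.getLast?_concat, List.getLast?_append,
            List.getLast?_replicate] at h0
          simpa using h0
      cases M with
      | nil =>
        -- a single letter cannot be `k` backward letters followed by `k` forward letters
        have h0 := congrArg List.length hkm
        simp at h0
        omega
      | cons l₁ M =>
        have hfirst : l₁.2 = false := by
          have h0 := congrArg List.head? hkm
          cases k with
          | zero => simp at h0
          | succ k => simpa [List.replicate_succ] using h0
        obtain ⟨hsrc, hrest⟩ := isPath_cons.1 hΓ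
        obtain ⟨c, hM, hlt⟩ := isPath_append_iff.1 hrest
        obtain ⟨hsrcₙ, htgtₙ⟩ := isPath_singleton.1 hlt
        obtain ⟨b, s⟩ := l₁
        obtain ⟨b', s'⟩ := lₙ
        simp only at hfirst hlast
        subst hfirst; subst hlast
        have hb : b ∈ T := hT (b, false) (by simp)
        have hb' : b' ∈ T := hT (b', true) (by simp)
        simp only [src_false] at hsrc
        simp only [tgt_true] at htgtₙ
        have hbb : b = b' := hinj b hb b' hb' (by rw [hsrc, htgtₙ])
        subst hbb
        simp only [src_true, tgt_false] at hsrcₙ hM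
        rw [← hsrcₙ] at hM
        have hlen : M.length < n := by rw [← hn]; simp
        have hmv := ih _ hlen _ M rfl hM fun l hl => hT l (by simp [hl])
        have h1 : MovesL [] ((b, false) :: (M ++ [(b, true)])) ([(b, false)] ++ [] ++ [(b, true)]) :=
          hmv.frame [(b, false)] [(b, true)]
        have h2 : Backtrack ([(b, false)] ++ [] ++ [(b, true)]) [] := ⟨[], (b, false), [], Or.inl ⟨by simp [opp], rfl⟩⟩
        simpa using h1.cancel h2

/-- **The comb is a forest**: potential `Σ_i x_i`, upper endpoints distinct by `endpt_injOn_combTree`.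
[cite: Federbush1987PhaseCellIII, §5.3 2)–3) p. 303] -/
theorem isForest_combTree (lo hi : Site d) : IsForest (combTree lo hi) := by
  refine isForest_of_potential (fun x => ∑ i, x i) (fun b _ => ?_) fun b hb b' hb' h => endpt_injOn_combTree lo hi hb hb' h
  simp only [Pi.add_apply, Finset.sum_add_distrib, ev, add_right_inj]
  rw [Finset.sum_pi_single']
  simp

/-- The plaquettes of a box are closed under reversing orientation. [cite: Federbush1987PhaseCellIII, §5.3 2) p. 303] -/
theorem swap_mem_boxPlaq {lo hi : Site d} {p : LatticeContour.Plaq d} (hp : p ∈ boxPlaq lo hi) :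
    (p.1, p.2.2, p.2.1) ∈ boxPlaq lo hi := by
  obtain ⟨hne, h1, h2⟩ := mem_boxPlaq.1 hp
  exact mem_boxPlaq.2 ⟨hne.symm, h1, by rwa [add_right_comm]⟩

/-- **The box is simply connected — second proof, through the machine**: the comb peels the box (`combPeeling`), peelings generate,
generation normally generates, and the comb is a spanning forest; independent of `SimplyConnectedBox.simplyConnected_box` (whose
column-flattening homotopies are not used). [cite: Federbush1987PhaseCellIII, §5.3 2)–3) p. 303] -/
theorem simplyConnected_box' (lo hi : Site d) : SimplyConnected (boxPlaq lo hi) (boxBonds lo hi) :=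
  simplyConnected_of_peeling (combPeeling lo hi) (combTree_subset lo hi) (spans_combTree lo hi) (isForest_combTree lo hi)
    fun _ hp => swap_mem_boxPlaq hp

/-- Hence for a box and ANY bond set `T ⊆` box spanning it that is a forest, the three notions coincide and hold: normal generation
by the based plaquette words, the flat Observation for every group, print's simple connectivity.
[cite: Federbush1987PhaseCellIII, §5.3 2) Observation p. 303] -/
theorem normallyGenerated_box {lo hi x₀ : Site d} {T : Set (Bond d)} (hT : T ⊆ boxBonds lo hi)
    (hspan : Spans T (boxBonds lo hi) x₀) : NormallyGenerated (boxPlaq lo hi) (boxBonds lo hi) T :=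
  normallyGenerated_of_simplyConnected (simplyConnected_box' lo hi) hT hspan

end Forest

end ObservationCriterion

end Literature.MathematicalPhysics.QuantumFieldTheory.Federbush1986
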